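import Literature.AlgebraicGeometry.HodgeTheory.WeilFamilyInvariantForms
import Mathlib.Analysis.InnerProductSpace.Adjoint
import Mathlib.Analysis.InnerProductSpace.Trace
import Mathlib.LinearAlgebra.Complex.Module
import Mathlib.Algebra.BigOperators.Pi
import HarnessLib

/-!
# Venture HSemireg — the bracket of two Weil-family directions: `[𝔭, 𝔭]` spans `𝔰(𝔲(n) ⊕ 𝔲(n))`

Vocabulary of `Literature.AlgebraicGeometry.HodgeTheory.WeilFamilyInvariantForms` (van Geemen, LNM 1594
§5.3–5.6): `U = P × P`, the family directions `T_B (x₁, x₂) = (B† x₂, B x₁)` (`offDiag B`), `B ∈ End_ℂ(P)`,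
and the rank-one operators `|w⟩⟨v|` (`rankOne w v`).

* `offDiag_comm`: the commutator of two directions is BLOCK-DIAGONAL,
  `T_B (T_C x) - T_C (T_B x) = ((B†C - C†B) x₁, (BC† - CB†) x₂)`;
* `adjoint_commFst` / `adjoint_commSnd`: both blocks are skew-adjoint; `trace_commFst_add_trace_commSnd`:
  their traces add up to `0` — i.e. `[𝔭, 𝔭] ⊆ 𝔨₀ := 𝔰(𝔲(P) ⊕ 𝔲(P))`
  (`adjoint_eq_neg_of_mem_bracketSpan_fst/snd`, `trace_add_trace_eq_zero_of_mem_bracketSpan`);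
* `mem_bracketSpan` (**the spanning theorem**): conversely EVERY pair `(S, T)` of skew-adjoint operators
  with `tr S + tr T = 0` is a real linear combination of commutator blocks:
  `𝔨₀ = span_ℝ [𝔭, 𝔭]` (the span is written out as `Submodule.span ℝ {(B†C - C†B, BC† - CB†)}` in every
  statement; the file introduces no definitions). Hence the real Lie algebra generated by `𝔭` is `𝔨₀ ⊕ 𝔭 = 𝔰𝔲(H)`
  (`H` the signature-`(n,n)` form of the Literature file), and anything annihilated by every direction
  `T_B` under a Lie-algebra action is annihilated by `𝔰𝔲(H)`.

Proof of the spanning theorem: with `B = |w⟩⟨v|`, `C = |w'⟩⟨v'|` the blocks are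
`(⟪w,w'⟫ |v⟩⟨v'| - ⟪w',w⟫ |v'⟩⟨v|, ⟪v,v'⟫ |w⟩⟨w'| - ⟪v',v⟫ |w'⟩⟨w|)` (`gen_mem_bracketSpan`); for a unit
`w = w'` and `v = e_j`, `v' = s̄_{jk} e_k` (`e` an orthonormal basis, `s_{jk} = ⟪e_j, S e_k⟫`) the sum over
`j, k` is `(S - S†, (conj(tr S) - tr S) |w⟩⟨w|) = (2S, -2 tr S |w⟩⟨w|)`; the set of commutator blocks is
invariant under swapping the two blocks (`B, C ↦ B†, C†`), which gives `(-tr T |w⟩⟨w|, T)`; and the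
missing diagonal correction `(-tr S |w⟩⟨w|, tr S |w⟩⟨w|)` is the single block of `B = |w⟩⟨w|`,
`C = |w⟩⟨(tr S / 2)‾ w|`.

HONEST FRAMING. Elementary linear algebra; Lean index of the computation cell `pub-hsemireg`, seat
`w1-tw-1` (W1), notes `widen/W1/CLEAN-COMPONENT-THEOREM-w1tw1.md` (THEOREM CC, step (S5♯)) and the
record's THEOREM T (3a): a cohomology class annihilated by every Weil direction (`𝔭⁺`, and by reality
`𝔭⁻`) is annihilated by `[𝔭, 𝔭] ⊇ 𝔨` and hence by `𝔰𝔲(H)`, so it is a generic Hodge class of the Weil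
component ([vG94] Thm. 6.12, printed; not formalised here). The derivation action on cohomology, the
invariant ring and every geometric statement are NOT constructed here; no abelian variety, Hodge class or
semiregularity map appears in this file; nothing here says that HC, HC_CM or HC_AV holds, and nothing
here is a new case of anything.
-/

noncomputable section

open Complex Module
open scoped InnerProductSpace ComplexConjugate

namespace Summit.Ventures.HSemireg

namespace WeilFamily

open Literature.AlgebraicGeometry.HodgeTheory.WeilFamily

variable {P : Type*} [NormedAddCommGroup P] [InnerProductSpace ℂ P] [FiniteDimensional ℂ P]

/-! ### The commutator of two directions -/

/-- `[T_B, T_C] (x₁, x₂) = ((B†C - C†B) x₁, (BC† - CB†) x₂)`: the commutator of two family directions is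
block-diagonal (the shape of `𝔨 = 𝔲(P) ⊕ 𝔲(P)`). [folklore] -/
theorem offDiag_comm (B C : P →ₗ[ℂ] P) (x : P × P) :
    offDiag B (offDiag C x) - offDiag C (offDiag B x) =
      ((LinearMap.adjoint B ∘ₗ C - LinearMap.adjoint C ∘ₗ B) x.1,
        (B ∘ₗ LinearMap.adjoint C - C ∘ₗ LinearMap.adjoint B) x.2) := by
  ext <;> simp [offDiag]

/-- The first block `B†C - C†B` is skew-adjoint. [folklore] -/
theorem adjoint_commFst (B C : P →ₗ[ℂ] P) :
    LinearMap.adjoint (LinearMap.adjoint B ∘ₗ C - LinearMap.adjoint C ∘ₗ B) =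
      -(LinearMap.adjoint B ∘ₗ C - LinearMap.adjoint C ∘ₗ B) := by
  simp only [map_sub, LinearMap.adjoint_comp, LinearMap.adjoint_adjoint]
  abel

/-- The second block `BC† - CB†` is skew-adjoint. [folklore] -/
theorem adjoint_commSnd (B C : P →ₗ[ℂ] P) :
    LinearMap.adjoint (B ∘ₗ LinearMap.adjoint C - C ∘ₗ LinearMap.adjoint B) =
      -(B ∘ₗ LinearMap.adjoint C - C ∘ₗ LinearMap.adjoint B) := by
  simp only [map_sub, LinearMap.adjoint_comp, LinearMap.adjoint_adjoint]
  abel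

/-- `tr(B†C - C†B) + tr(BC† - CB†) = 0`: the commutator blocks lie in `𝔰(𝔲 ⊕ 𝔲)`. [folklore] -/
theorem trace_commFst_add_trace_commSnd (B C : P →ₗ[ℂ] P) :
    LinearMap.trace ℂ P (LinearMap.adjoint B ∘ₗ C - LinearMap.adjoint C ∘ₗ B) +
      LinearMap.trace ℂ P (B ∘ₗ LinearMap.adjoint C - C ∘ₗ LinearMap.adjoint B) = 0 := by
  simp only [map_sub]
  rw [LinearMap.trace_comp_comm' C (LinearMap.adjoint B),
    LinearMap.trace_comp_comm' B (LinearMap.adjoint C)]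
  ring

/-! ### The real span of the commutator blocks

`span_ℝ [𝔭, 𝔭]` is written out in every statement as
`Submodule.span ℝ {p | ∃ B C, p = (B†C - C†B, BC† - CB†)}` (pairs of diagonal blocks). -/

/-- Each commutator block lies in the span. [folklore] -/
theorem comm_mem_bracketSpan (B C : P →ₗ[ℂ] P) :
    (LinearMap.adjoint B ∘ₗ C - LinearMap.adjoint C ∘ₗ B, B ∘ₗ LinearMap.adjoint C - C ∘ₗ LinearMap.adjoint B) ∈
      (Submodule.span ℝ {p : (P →ₗ[ℂ] P) × (P →ₗ[ℂ] P) | ∃ B C : P →ₗ[ℂ] P,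
        p = (LinearMap.adjoint B ∘ₗ C - LinearMap.adjoint C ∘ₗ B, B ∘ₗ LinearMap.adjoint C - C ∘ₗ LinearMap.adjoint B)}) :=
  Submodule.subset_span ⟨B, C, rfl⟩

/-- The span is invariant under swapping the two blocks (`B, C ↦ B†, C†` swaps them). [folklore] -/
theorem swap_mem_bracketSpan {S T : P →ₗ[ℂ] P}
    (h : (S, T) ∈ (Submodule.span ℝ {p : (P →ₗ[ℂ] P) × (P →ₗ[ℂ] P) | ∃ B C : P →ₗ[ℂ] P,
        p = (LinearMap.adjoint B ∘ₗ C - LinearMap.adjoint C ∘ₗ B, B ∘ₗ LinearMap.adjoint C - C ∘ₗ LinearMap.adjoint B)})) :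
    (T, S) ∈ (Submodule.span ℝ {p : (P →ₗ[ℂ] P) × (P →ₗ[ℂ] P) | ∃ B C : P →ₗ[ℂ] P,
        p = (LinearMap.adjoint B ∘ₗ C - LinearMap.adjoint C ∘ₗ B, B ∘ₗ LinearMap.adjoint C - C ∘ₗ LinearMap.adjoint B)}) := by
  let σ : ((P →ₗ[ℂ] P) × (P →ₗ[ℂ] P)) →ₗ[ℝ] ((P →ₗ[ℂ] P) × (P →ₗ[ℂ] P)) :=
    (LinearEquiv.prodComm ℝ (P →ₗ[ℂ] P) (P →ₗ[ℂ] P)).toLinearMap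
  have hσ : (T, S) = σ (S, T) := rfl
  rw [hσ]
  refine (show Submodule.map σ _ ≤ _ from ?_) (Submodule.mem_map_of_mem h)
  rw [Submodule.map_span, Submodule.span_le]
  rintro _ ⟨p, ⟨B, C, rfl⟩, rfl⟩
  refine Submodule.subset_span ⟨LinearMap.adjoint B, LinearMap.adjoint C, ?_⟩
  simp [σ, LinearMap.adjoint_adjoint]

/-! ### `[𝔭, 𝔭] ⊆ 𝔨₀`: every element of the span is a skew-adjoint pair of total trace zero -/

/-- First block of an element of `span_ℝ [𝔭,𝔭]` is skew-adjoint (general element). [folklore] -/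
theorem adjoint_fst_eq_neg_of_mem_bracketSpan {p : (P →ₗ[ℂ] P) × (P →ₗ[ℂ] P)}
    (hp : p ∈ (Submodule.span ℝ {p : (P →ₗ[ℂ] P) × (P →ₗ[ℂ] P) | ∃ B C : P →ₗ[ℂ] P,
        p = (LinearMap.adjoint B ∘ₗ C - LinearMap.adjoint C ∘ₗ B, B ∘ₗ LinearMap.adjoint C - C ∘ₗ LinearMap.adjoint B)})) :
    LinearMap.adjoint p.1 = -p.1 := by
  induction hp using Submodule.span_induction with
  | mem p hp =>
      obtain ⟨B, C, rfl⟩ := hp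
      exact adjoint_commFst B C
  | zero => simp
  | add p q _ _ hp hq =>
      rw [Prod.fst_add, map_add, hp, hq, neg_add]
  | smul r p _ hp =>
      rw [Prod.smul_fst, ← Complex.coe_smul, map_smulₛₗ, hp, Complex.conj_ofReal, smul_neg]

/-- First block of an element of `span_ℝ [𝔭,𝔭]` is skew-adjoint. [folklore] -/
theorem adjoint_eq_neg_of_mem_bracketSpan_fst {S T : P →ₗ[ℂ] P}
    (h : (S, T) ∈ (Submodule.span ℝ {p : (P →ₗ[ℂ] P) × (P →ₗ[ℂ] P) | ∃ B C : P →ₗ[ℂ] P,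
        p = (LinearMap.adjoint B ∘ₗ C - LinearMap.adjoint C ∘ₗ B, B ∘ₗ LinearMap.adjoint C - C ∘ₗ LinearMap.adjoint B)})) :
    LinearMap.adjoint S = -S := by
  simpa using adjoint_fst_eq_neg_of_mem_bracketSpan h

/-- Second block of an element of `span_ℝ [𝔭,𝔭]` is skew-adjoint. [folklore] -/
theorem adjoint_eq_neg_of_mem_bracketSpan_snd {S T : P →ₗ[ℂ] P}
    (h : (S, T) ∈ (Submodule.span ℝ {p : (P →ₗ[ℂ] P) × (P →ₗ[ℂ] P) | ∃ B C : P →ₗ[ℂ] P,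
        p = (LinearMap.adjoint B ∘ₗ C - LinearMap.adjoint C ∘ₗ B, B ∘ₗ LinearMap.adjoint C - C ∘ₗ LinearMap.adjoint B)})) :
    LinearMap.adjoint T = -T := by
  simpa using adjoint_fst_eq_neg_of_mem_bracketSpan (swap_mem_bracketSpan h)

/-- Total trace of an element of `span_ℝ [𝔭,𝔭]` is zero (general element). [folklore] -/
theorem trace_add_trace_eq_zero_of_mem_bracketSpan' {p : (P →ₗ[ℂ] P) × (P →ₗ[ℂ] P)}
    (hp : p ∈ (Submodule.span ℝ {p : (P →ₗ[ℂ] P) × (P →ₗ[ℂ] P) | ∃ B C : P →ₗ[ℂ] P,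
        p = (LinearMap.adjoint B ∘ₗ C - LinearMap.adjoint C ∘ₗ B, B ∘ₗ LinearMap.adjoint C - C ∘ₗ LinearMap.adjoint B)})) :
    LinearMap.trace ℂ P p.1 + LinearMap.trace ℂ P p.2 = 0 := by
  induction hp using Submodule.span_induction with
  | mem p hp =>
      obtain ⟨B, C, rfl⟩ := hp
      exact trace_commFst_add_trace_commSnd B C
  | zero => simp
  | add p q _ _ hp hq =>
      rw [Prod.fst_add, Prod.snd_add, map_add, map_add]
      linear_combination hp + hq
  | smul r p _ hp =>
      rw [Prod.smul_fst, Prod.smul_snd, ← Complex.coe_smul, ← Complex.coe_smul, map_smul, map_smul,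
        smul_eq_mul, smul_eq_mul, ← mul_add, hp, mul_zero]

/-- Total trace of an element of `span_ℝ [𝔭,𝔭]` is zero. [folklore] -/
theorem trace_add_trace_eq_zero_of_mem_bracketSpan {S T : P →ₗ[ℂ] P}
    (h : (S, T) ∈ (Submodule.span ℝ {p : (P →ₗ[ℂ] P) × (P →ₗ[ℂ] P) | ∃ B C : P →ₗ[ℂ] P,
        p = (LinearMap.adjoint B ∘ₗ C - LinearMap.adjoint C ∘ₗ B, B ∘ₗ LinearMap.adjoint C - C ∘ₗ LinearMap.adjoint B)})) :
    LinearMap.trace ℂ P S + LinearMap.trace ℂ P T = 0 := by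
  simpa using trace_add_trace_eq_zero_of_mem_bracketSpan' h

/-! ### Rank-one bookkeeping -/

/-- `(|w⟩⟨v|)† = |v⟩⟨w|` as linear maps. [folklore] -/
theorem adjoint_rankOne (w v : P) : LinearMap.adjoint (rankOne w v) = rankOne v w := by
  ext y
  rw [adjoint_rankOne_apply, rankOne_apply]

omit [FiniteDimensional ℂ P] in
/-- `|a⟩⟨b| ∘ |c⟩⟨d| = ⟪b, c⟫ |a⟩⟨d|`. [folklore] -/
theorem rankOne_comp_rankOne (a b c d : P) :
    rankOne a b ∘ₗ rankOne c d = ⟪b, c⟫_ℂ • rankOne a d := by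
  ext x
  simp only [LinearMap.coe_comp, Function.comp_apply, rankOne_apply, inner_smul_right,
    LinearMap.smul_apply, smul_smul, mul_comm]

omit [FiniteDimensional ℂ P] in
/-- `|w⟩⟨c v| = c̄ |w⟩⟨v|`. [folklore] -/
theorem rankOne_smul_right (w v : P) (c : ℂ) : rankOne w (c • v) = conj c • rankOne w v := by
  ext x
  simp only [rankOne_apply, inner_smul_left, LinearMap.smul_apply, smul_smul]

omit [FiniteDimensional ℂ P] in
/-- `|c w⟩⟨v| = c |w⟩⟨v|`. [folklore] -/
theorem rankOne_smul_left (w v : P) (c : ℂ) : rankOne (c • w) v = c • rankOne w v := by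
  ext x
  simp only [rankOne_apply, LinearMap.smul_apply, smul_smul, mul_comm]

/-- The commutator blocks of two rank-one directions:
`[T_{|w⟩⟨v|}, T_{|w'⟩⟨v'|}] = D(⟪w,w'⟫ |v⟩⟨v'| - ⟪w',w⟫ |v'⟩⟨v|, ⟪v,v'⟫ |w⟩⟨w'| - ⟪v',v⟫ |w'⟩⟨w|)`.
[folklore] -/
theorem comm_rankOne (w v w' v' : P) :
    (LinearMap.adjoint (rankOne w v) ∘ₗ rankOne w' v' - LinearMap.adjoint (rankOne w' v') ∘ₗ rankOne w v,
      rankOne w v ∘ₗ LinearMap.adjoint (rankOne w' v') - rankOne w' v' ∘ₗ LinearMap.adjoint (rankOne w v)) =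
      (⟪w, w'⟫_ℂ • rankOne v v' - ⟪w', w⟫_ℂ • rankOne v' v,
        ⟪v, v'⟫_ℂ • rankOne w w' - ⟪v', v⟫_ℂ • rankOne w' w) := by
  simp only [adjoint_rankOne, rankOne_comp_rankOne]

/-- Hence every such pair lies in `span_ℝ [𝔭,𝔭]`. [folklore] -/
theorem gen_mem_bracketSpan (w v w' v' : P) :
    (⟪w, w'⟫_ℂ • rankOne v v' - ⟪w', w⟫_ℂ • rankOne v' v,
        ⟪v, v'⟫_ℂ • rankOne w w' - ⟪v', v⟫_ℂ • rankOne w' w) ∈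
      (Submodule.span ℝ {p : (P →ₗ[ℂ] P) × (P →ₗ[ℂ] P) | ∃ B C : P →ₗ[ℂ] P,
        p = (LinearMap.adjoint B ∘ₗ C - LinearMap.adjoint C ∘ₗ B, B ∘ₗ LinearMap.adjoint C - C ∘ₗ LinearMap.adjoint B)}) := by
  rw [← comm_rankOne]
  exact comm_mem_bracketSpan _ _

/-- With a unit vector `w` (`⟪w, w⟫ = 1`) in the first slot and `v' = c̄ u`:
`(c |v⟩⟨u| - c̄ |u⟩⟨v|, (c̄ ⟪v,u⟫ - c ⟪u,v⟫) |w⟩⟨w|) ∈ span_ℝ [𝔭,𝔭]`. [folklore] -/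
theorem gen_mem_bracketSpan_unit {w : P} (hw : ⟪w, w⟫_ℂ = 1) (v u : P) (c : ℂ) :
    (c • rankOne v u - conj c • rankOne u v,
        (conj c * ⟪v, u⟫_ℂ - c * ⟪u, v⟫_ℂ) • rankOne w w) ∈
      (Submodule.span ℝ {p : (P →ₗ[ℂ] P) × (P →ₗ[ℂ] P) | ∃ B C : P →ₗ[ℂ] P,
        p = (LinearMap.adjoint B ∘ₗ C - LinearMap.adjoint C ∘ₗ B, B ∘ₗ LinearMap.adjoint C - C ∘ₗ LinearMap.adjoint B)}) := by
  have h := gen_mem_bracketSpan w v w (conj c • u)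
  rw [hw, one_smul, one_smul, rankOne_smul_right, rankOne_smul_left, Complex.conj_conj,
    inner_smul_right, inner_smul_left, Complex.conj_conj, ← sub_smul] at h
  exact h

/-! ### Expansion of an operator in an orthonormal basis -/

section Expansion

variable {ι : Type*} [Fintype ι] (b : OrthonormalBasis ι ℂ P)

omit [FiniteDimensional ℂ P] in
/-- `S = Σ_{j,k} ⟪e_j, S e_k⟫ |e_j⟩⟨e_k|`. [folklore] -/
theorem sum_inner_smul_rankOne (S : P →ₗ[ℂ] P) :
    ∑ j, ∑ k, ⟪b j, S (b k)⟫_ℂ • rankOne (b j) (b k) = S := by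
  apply LinearMap.ext
  intro x
  have hx : S x = ∑ k, ⟪b k, x⟫_ℂ • S (b k) := by
    conv_lhs => rw [← b.sum_repr' x]
    simp only [map_sum, map_smul]
  have hSk : ∀ k, S (b k) = ∑ j, ⟪b j, S (b k)⟫_ℂ • b j := fun k ↦ (b.sum_repr' _).symm
  rw [hx]
  simp only [LinearMap.coe_sum, Finset.sum_apply, LinearMap.smul_apply, rankOne_apply, smul_smul]
  rw [Finset.sum_comm]
  refine Finset.sum_congr rfl fun k _ ↦ ?_
  conv_rhs => rw [hSk k, Finset.smul_sum]
  refine Finset.sum_congr rfl fun j _ ↦ ?_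
  simp only [smul_smul, mul_comm]

/-- `S† = Σ_{j,k} conj ⟪e_j, S e_k⟫ |e_k⟩⟨e_j|`. [folklore] -/
theorem sum_conj_inner_smul_rankOne (S : P →ₗ[ℂ] P) :
    ∑ j, ∑ k, conj ⟪b j, S (b k)⟫_ℂ • rankOne (b k) (b j) = LinearMap.adjoint S := by
  have h := sum_inner_smul_rankOne b (LinearMap.adjoint S)
  rw [Finset.sum_comm] at h
  rw [← h]
  refine Finset.sum_congr rfl fun j _ ↦ Finset.sum_congr rfl fun k _ ↦ ?_
  rw [LinearMap.adjoint_inner_right, inner_conj_symm]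

end Expansion

/-- `conj (tr S) = tr S†`. [folklore] -/
theorem conj_trace_eq_trace_adjoint (S : P →ₗ[ℂ] P) :
    conj (LinearMap.trace ℂ P S) = LinearMap.trace ℂ P (LinearMap.adjoint S) := by
  rw [LinearMap.trace_eq_sum_inner S (stdOrthonormalBasis ℂ P),
    LinearMap.trace_eq_sum_inner _ (stdOrthonormalBasis ℂ P), map_sum]
  refine Finset.sum_congr rfl fun j _ ↦ ?_
  rw [LinearMap.adjoint_inner_right, inner_conj_symm]

/-- A skew-adjoint operator has `conj (tr S) = -tr S`. [folklore] -/
theorem conj_trace_of_skewAdjoint {S : P →ₗ[ℂ] P} (hS : LinearMap.adjoint S = -S) :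
    conj (LinearMap.trace ℂ P S) = -LinearMap.trace ℂ P S := by
  rw [conj_trace_eq_trace_adjoint S, hS, map_neg]

/-! ### The spanning theorem -/

/-- KEY STEP: for a skew-adjoint `S` and a unit vector `w`,
`(S, -(tr S) |w⟩⟨w|) ∈ span_ℝ [𝔭,𝔭]` — sum the unit generators over an orthonormal basis
(`v = e_j`, `u = e_k`, `c = ⟪e_j, S e_k⟫`): the first blocks add up to `S - S† = 2S`, the second to
`(conj (tr S) - tr S) |w⟩⟨w| = -2 (tr S) |w⟩⟨w|`. [folklore] -/
theorem skew_mem_bracketSpan {S : P →ₗ[ℂ] P} (hS : LinearMap.adjoint S = -S) {w : P}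
    (hw : ⟪w, w⟫_ℂ = 1) :
    (S, -(LinearMap.trace ℂ P S) • rankOne w w) ∈
      (Submodule.span ℝ {p : (P →ₗ[ℂ] P) × (P →ₗ[ℂ] P) | ∃ B C : P →ₗ[ℂ] P,
        p = (LinearMap.adjoint B ∘ₗ C - LinearMap.adjoint C ∘ₗ B, B ∘ₗ LinearMap.adjoint C - C ∘ₗ LinearMap.adjoint B)}) := by
  classical
  set b := stdOrthonormalBasis ℂ P with hb
  -- the sum of the unit generators
  have hsum : (∑ j, ∑ k, (⟪b j, S (b k)⟫_ℂ • rankOne (b j) (b k)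
        - conj ⟪b j, S (b k)⟫_ℂ • rankOne (b k) (b j),
      (conj ⟪b j, S (b k)⟫_ℂ * ⟪b j, b k⟫_ℂ - ⟪b j, S (b k)⟫_ℂ * ⟪b k, b j⟫_ℂ) • rankOne w w)) ∈
      (Submodule.span ℝ {p : (P →ₗ[ℂ] P) × (P →ₗ[ℂ] P) | ∃ B C : P →ₗ[ℂ] P,
        p = (LinearMap.adjoint B ∘ₗ C - LinearMap.adjoint C ∘ₗ B, B ∘ₗ LinearMap.adjoint C - C ∘ₗ LinearMap.adjoint B)}) := by
    refine Submodule.sum_mem _ fun j _ ↦ Submodule.sum_mem _ fun k _ ↦ ?_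
    exact gen_mem_bracketSpan_unit hw (b j) (b k) _
  -- evaluate the first block: `S - S† = 2 S`
  have h1 : ∑ j, ∑ k, (⟪b j, S (b k)⟫_ℂ • rankOne (b j) (b k)
        - conj ⟪b j, S (b k)⟫_ℂ • rankOne (b k) (b j)) = (2 : ℂ) • S := by
    simp only [Finset.sum_sub_distrib]
    rw [sum_inner_smul_rankOne b S, sum_conj_inner_smul_rankOne b S, hS, two_smul]
    abel
  -- evaluate the second block: `(conj tr S - tr S) |w⟩⟨w| = -2 tr S |w⟩⟨w|`
  have h2 : ∑ j, ∑ k, (conj ⟪b j, S (b k)⟫_ℂ * ⟪b j, b k⟫_ℂ - ⟪b j, S (b k)⟫_ℂ * ⟪b k, b j⟫_ℂ)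
        • rankOne w w = ((2 : ℂ) * -(LinearMap.trace ℂ P S)) • rankOne w w := by
    simp only [← Finset.sum_smul]
    congr 1
    have hdiag : ∀ j, ∑ k, (conj ⟪b j, S (b k)⟫_ℂ * ⟪b j, b k⟫_ℂ - ⟪b j, S (b k)⟫_ℂ * ⟪b k, b j⟫_ℂ)
        = conj ⟪b j, S (b j)⟫_ℂ - ⟪b j, S (b j)⟫_ℂ := by
      intro j
      rw [Finset.sum_eq_single j]
      · rw [b.inner_eq_one, mul_one, mul_one]
      · intro k _ hkj
        rw [b.inner_eq_zero (Ne.symm hkj), b.inner_eq_zero hkj, mul_zero, mul_zero, sub_zero]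
      · intro hj; exact absurd (Finset.mem_univ j) hj
    simp only [hdiag, Finset.sum_sub_distrib]
    rw [← map_sum, ← LinearMap.trace_eq_sum_inner S b, conj_trace_of_skewAdjoint hS]
    ring
  -- assemble
  simp only [← prod_mk_sum] at hsum
  rw [h1, h2] at hsum
  have e : ((2 : ℂ) • S, ((2 : ℂ) * -(LinearMap.trace ℂ P S)) • rankOne w w)
      = (2 : ℝ) • (S, -(LinearMap.trace ℂ P S) • rankOne w w) := by
    rw [Prod.smul_mk, ← Complex.coe_smul, ← Complex.coe_smul, smul_smul, Complex.ofReal_ofNat]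
  rw [e] at hsum
  exact (Submodule.smul_mem_iff _ (two_ne_zero)).1 hsum

/-- The diagonal correction: for a unit `w` and a purely imaginary `t` (`conj t = -t`),
`(t |w⟩⟨w|, -t |w⟩⟨w|) ∈ span_ℝ [𝔭,𝔭]` (the block of `B = |w⟩⟨w|`, `C = |w⟩⟨(t/2)‾ w|`). [folklore] -/
theorem diag_mem_bracketSpan {w : P} (hw : ⟪w, w⟫_ℂ = 1) {t : ℂ} (ht : conj t = -t) :
    (t • rankOne w w, -t • rankOne w w) ∈
      (Submodule.span ℝ {p : (P →ₗ[ℂ] P) × (P →ₗ[ℂ] P) | ∃ B C : P →ₗ[ℂ] P,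
        p = (LinearMap.adjoint B ∘ₗ C - LinearMap.adjoint C ∘ₗ B, B ∘ₗ LinearMap.adjoint C - C ∘ₗ LinearMap.adjoint B)}) := by
  have h := gen_mem_bracketSpan_unit hw w w (t / 2)
  have hc : conj (t / 2) = -(t / 2) := by
    rw [map_div₀, ht, map_ofNat]; ring
  rw [hc, hw, mul_one, mul_one, ← sub_smul] at h
  have e1 : t / 2 - -(t / 2) = t := by ring
  have e2 : -(t / 2) - t / 2 = -t := by ring
  rwa [e1, e2] at h

/-- **`𝔨₀ = span_ℝ [𝔭, 𝔭]` (the spanning theorem).** Let `dim_ℂ P ≥ 1`. A pair `(S, T)` of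
skew-adjoint operators on `P` with `tr S + tr T = 0` is a real linear combination of commutator blocks
`(B†C - C†B, BC† - CB†)` of Weil-family directions. Consequently the real Lie algebra generated by
`𝔭 = {T_B}` contains `𝔨₀ = 𝔰(𝔲(P) ⊕ 𝔲(P))` and equals `𝔨₀ ⊕ 𝔭 = 𝔰𝔲(H)`; in the cell's use
(THEOREM T (3a) / THEOREM CC (S5♯)): a class killed by every Weil direction is killed by `𝔰𝔲(H)`.
[folklore] -/
theorem mem_bracketSpan (h1 : 1 ≤ finrank ℂ P) {S T : P →ₗ[ℂ] P}
    (hS : LinearMap.adjoint S = -S) (hT : LinearMap.adjoint T = -T)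
    (htr : LinearMap.trace ℂ P S + LinearMap.trace ℂ P T = 0) :
    (S, T) ∈ (Submodule.span ℝ {p : (P →ₗ[ℂ] P) × (P →ₗ[ℂ] P) | ∃ B C : P →ₗ[ℂ] P,
        p = (LinearMap.adjoint B ∘ₗ C - LinearMap.adjoint C ∘ₗ B, B ∘ₗ LinearMap.adjoint C - C ∘ₗ LinearMap.adjoint B)}) := by
  -- a unit vector
  obtain ⟨w, hw⟩ : ∃ w : P, ⟪w, w⟫_ℂ = 1 := by
    have : 0 < finrank ℂ P := h1
    obtain ⟨i⟩ : Nonempty (Fin (finrank ℂ P)) := ⟨⟨0, this⟩⟩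
    exact ⟨stdOrthonormalBasis ℂ P i, (stdOrthonormalBasis ℂ P).inner_eq_one i⟩
  have hA := skew_mem_bracketSpan hS hw
  have hB := swap_mem_bracketSpan (skew_mem_bracketSpan hT hw)
  have htT : LinearMap.trace ℂ P T = -LinearMap.trace ℂ P S := by linear_combination htr
  have hC := diag_mem_bracketSpan hw (t := -LinearMap.trace ℂ P S)
    (by rw [map_neg, conj_trace_of_skewAdjoint hS])
  have := Submodule.add_mem _ (Submodule.add_mem _ hA hB) hC
  convert this using 1
  ext1
  · simp only [Prod.fst_add, htT, neg_neg, neg_smul]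
    abel
  · simp only [Prod.snd_add, neg_neg, neg_smul]
    abel

/-- The characterisation in one statement: for `dim_ℂ P ≥ 1`,
`(S, T) ∈ span_ℝ [𝔭,𝔭] ↔ S† = -S ∧ T† = -T ∧ tr S + tr T = 0`. [folklore] -/
theorem mem_bracketSpan_iff (h1 : 1 ≤ finrank ℂ P) (S T : P →ₗ[ℂ] P) :
    (S, T) ∈ (Submodule.span ℝ {p : (P →ₗ[ℂ] P) × (P →ₗ[ℂ] P) | ∃ B C : P →ₗ[ℂ] P,
        p = (LinearMap.adjoint B ∘ₗ C - LinearMap.adjoint C ∘ₗ B, B ∘ₗ LinearMap.adjoint C - C ∘ₗ LinearMap.adjoint B)}) ↔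
      LinearMap.adjoint S = -S ∧ LinearMap.adjoint T = -T ∧
        LinearMap.trace ℂ P S + LinearMap.trace ℂ P T = 0 :=
  ⟨fun h ↦ ⟨adjoint_eq_neg_of_mem_bracketSpan_fst h, adjoint_eq_neg_of_mem_bracketSpan_snd h,
    trace_add_trace_eq_zero_of_mem_bracketSpan h⟩,
    fun ⟨hS, hT, htr⟩ ↦ mem_bracketSpan h1 hS hT htr⟩

end WeilFamily

end Summit.Ventures.HSemireg

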